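import Mathlib
import HarnessLib
import Summits.BirchSwinnertonDyer.BirchSwinnertonDyer.Theses.ManinLocalTwoThree
import Summits.BirchSwinnertonDyer.BirchSwinnertonDyer.Theorems.ManinLocalTwoThreeCDivisionIndexFourRationalTwoTorsion
import Literature.NumberTheory.Automorphic.UnboundedDenominators

/-!
# Lines/cdivision_udc_theta_candidate.lean — CANDIDATE (width seat p3 gen 19, 2026-08-30T05:5xZ) for the c-division line of C2 `ManinOddAtFour`:
# TWO stubs — CDT Theorem 1.0.1 VERBATIM (printed, ℤ-coefficients) and the ONE law E-an-152e `ShimuraIndexNeFourAtFourFreyHabitat`.  NO F★, NO CES.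
#
# What changed w.r.t. the line of record v4 (`Lines/cdivision_udc.lean`, stubs CDT, F★, CES, 152e): E-an-152d is now a KERNEL THEOREM in exactly the form the
# composition needs — `CDivTranslate.exists_three_hasRationalTwoTorsionX_of_indexFour`: lattice clause ∧ `|c₀| = 2` ∧ `Λ₁(f) = 2Λ₀(f)` ⟹ three distinct rational
# `2`-torsion abscissae (p3 g19 files …CDivisionHalfPeriodGerms/Translates/TranslateSigns/GaloisEngine/FullTwoTorsion + anchors …EtaQuotientJacobiCharacter/
# ThetaFourIntegerQSeries/ThetaAnchorForms/SignCharacterKronecker/AnchorDischarge + capstone …CDivisionIndexFourRationalTwoTorsion; std axioms).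
# MECHANISM: in the index-4 world the four translates `F_κ` (κ ∈ Λ₀/Λ_W ≅ (ℤ/2)²) of the c-division witness `F = 12℘_{Λ_W}(ℰ_f)·G·Δ^a` have q-expansions
# polynomial over ℚ in the half-period values `e_κ = ℘_{Λ_W}(κ)`; the sign combination `A = F₀ + F_α − F_β − F_γ` is a Γ₀(N)-eigenfunction with an even quadratic
# character χ trivial on Γ₁(N); the anchor `g = ϑ₄(2τ)³ϑ₄(2q₀τ)` (Newman eta quotient, character (q₀/·) = χ by Montgomery–Vaughan 9.13) makes `Z = A·g·Δ^b` a cusp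
# form on Γ₀(16N) with coefficients in ℚ(e_α, e_β, e_γ); for σ ∈ Aut(ℂ) the σ-conjugate (Shimura 3.52 integral basis) is again Γ₀(16N)-invariant, which at a
# matrix δ with cusp class α is impossible unless σ fixes the class of α ⟹ σ(e_α) = e_α ⟹ e_α ∈ ℚ ⟹ `x = e_α − b₂/12` is a rational 2-torsion abscissa.
# With p2's integer-CDT chain (`CDivisionInt`: Λ₁(f) ⊆ Λ_W, c₀ ∣ 2, |c₀| = 1 at odd p² ∣ N) this gives the COMPOSITION
# `CDivTranslate.maninOddAtFour_of_CDTInt_freyHabitat' : CDT → E-an-152e → ManinOddAtFour` and the whole route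
# `CDivTranslate.maninConstantOne_of_printedFacts_CDTInt_freyHabitat'`.
# HONEST FRAMING: CONDITIONAL reduction; CDT Thm 1.0.1 (JAMS 2025) is PRINTED, statement-only; E-an-152e is OPEN (habitat by data: N = 32m, Kodaira III,
# tors (ℤ/2)²; LEAD memos v40/v41); BSD is not proved; Manin's conjecture is not proved.
-/

set_option autoImplicit false
set_option linter.dupNamespace false

noncomputable section

namespace Summit.BirchSwinnertonDyer.BirchSwinnertonDyer.Cruxes.ManinOddAtFour.CDivisionUDCTheta

/-- STUB (PRINTED) CDT Theorem 1.0.1 as printed (`CalegariDimitrovTang2025_unboundedDenominators`, ℤ-coefficients); CITE-ONLY. -/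
theorem stub_CDT : Literature.NumberTheory.Automorphic.CalegariDimitrovTang2025_unboundedDenominators := by
  sorry

/-- STUB (LAW) E-an-152e `CDivisionNeron.ShimuraIndexNeFourAtFourFreyHabitat` (an g45, by name) — no lattice-optimal `X₀(N)`-datum of a globally minimal curve
WITH FULL RATIONAL 2-TORSION, at `4 ∣ N` with no odd square dividing `N`, has `Λ₁(f) = 2Λ₀(f)`.  THE residual of the route (mod the printed theorem).
Hardest (only) stub. -/
theorem stub_shimuraIndexNeFourAtFourFreyHabitat :
    Summit.BirchSwinnertonDyer.BirchSwinnertonDyer.Theorems.ManinLocalTwoThree.CDivisionNeron.ShimuraIndexNeFourAtFourFreyHabitat := by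
  sorry

/-- COMPOSITION (no sorry): `CDivTranslate.maninOddAtFour_of_CDTInt_freyHabitat'` (p3 g19). -/
theorem ManinOddAtFour_of :
    Summit.BirchSwinnertonDyer.BirchSwinnertonDyer.Theses.ManinLocalTwoThree.ManinOddAtFour :=
  Summit.BirchSwinnertonDyer.BirchSwinnertonDyer.Theorems.ManinLocalTwoThree.CDivTranslate.maninOddAtFour_of_CDTInt_freyHabitat'
    stub_CDT stub_shimuraIndexNeFourAtFourFreyHabitat

end Summit.BirchSwinnertonDyer.BirchSwinnertonDyer.Cruxes.ManinOddAtFour.CDivisionUDCTheta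

end
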